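import Summits.QuantumFields.BalabanUV.T4Continuum.Support.NE7ProfileFieldFlat
import Summits.QuantumFields.BalabanUV.T4Continuum.Support.NE7PinnedLandauLettersOfLHCI
import HarnessLib

/-!
# NE7CornerBumpFlatLHCI — THE SMOOTH CORNER BUMP (quartic `C¹` profile with margin 3, centred at the corners) AND THE LANDAU-HARMONIC CORNER INTERPOLATION OF ITS
# TEST CLASS AT THE FLAT BACKGROUND, EXPLICIT: `η = a(0) + Φ_ρ((ρ(s))⁻¹(a − a(0)))`, `‖Δ_1η‖ ≤ 96·d·256^d·‖a‖∕M²` — F90's letters `hI`∕`hIR` DISCHARGED at `W = 1`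
# for the bump class; file 27

Cell `pub-balaban`, rung (B)+1 sub-cell t4, lineage `b2b-balaban-t4-ne7-p1` (CRUX PROVER NE7 #1 = OWNER of row NE7), generation 78; memo
`t4/b2b-balaban-t4-ne7-p1-g78/BUMP-CLASS-FLAT.md` §2–§3.  File F96 (over F95 `NE7ProfileFieldFlat`, row NE3's flat dictionary `FlatBlockHarmonicInverse.sum_hsR_covLapSite_comm`,
`LandauCorrectionSupB8FlatUnit.sum_covLapSite_flatCfg_eq_zero`, `LandauProjectionB8.sum_hsR_gaugeDir_gaugeDir_covLapSite`, and F90's letter shapes).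
WHY (memo g77 `GAUGED-TOP-TT.md` §12; memo g78 §2).  F90 `NE7PinnedLandauLettersOfLHCI` reduces «REP WITH A FIXED TOP (PG-T)» to the Galerkin letters of the test class `T`
plus the LHCI of `T` (`hI`∕`hIR`: every skew `N`-periodic corner datum `a` is interpolated by a skew periodic `η`, `η(M•w) = a(w)`, whose gauge direction is Landau
against `T`, with `‖Δη‖ ≤ (C_I∕M²)‖a‖`; `hUniq`).  For the block-mean classes the LHCI is a coarse circulant (flat numerics only).  THE BUMP CLASS: with the profile
`ρ(r) = Π_i ψ(r_i)`, `ψ(t) = ((t−2)(M−2−t))²` on `2 ≤ t ≤ M−2` (else `0`; support `[3, M−3]`, `C¹`, second differences `≤ 3M²`, `ψ(⌊M∕2⌋) ≥ M⁴∕4096`), read in the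
blocks centred at the corners (`s = ⌊M∕2⌋·𝟙`), the class `T^ρ_W` is: `ν` is `hsR`-orthogonal (i) to `Δ_W²(Φ_ρ C)` for every skew `N`-periodic coarse datum `C` VANISHING on the
corner class of `0`, and (ii) to `Φ_ρ C` for every such datum SUPPORTED on the class of `0` (the smeared mean at the corner `0` — it sees the constants).  Then at `W = 1`
the LHCI is EXPLICIT: `η := a(0) + Φ_ρ((ρ s)⁻¹·(a − a(0)))` has the corner values `a`, `Δ_1η = Φ_{Lρ}(…)` pairs to zero with `Δ_1ν` for `ν ∈ T^ρ` by (i) and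
`Σ_yΔ_1(Δ_1ν) = 0`, and `‖Δ_1η‖ ≤ 3dM²(M⁴∕16)^{d−1}·(4096∕M⁴)^d·2‖a‖ = 96d·256^d‖a‖∕M²`.
WHAT ([folklore]; 0 def, 0 sorry; the profile, the shift and the class enter as EQUATIONAL HYPOTHESES `hψ`, `hρ`, `hs`, `hT` — no definition is introduced).
§1 the profile: `psi_nonneg`, `psi_le`, `psi_support`, `abs_sdiff_psi_le` (`M ≥ 8`), `psi_mid`; §2 the bump: `rho_nonneg`, `rho_le`, `rho_support`, `rho_boundaryFree`,
`rho_mid_pos`, **`abs_lap_rho_le`** (`|Lρ| ≤ 3dM²(M⁴∕16)^{d−1}`); §3 **`exists_lhci_flatCfg_bump`** — F90's `hIR` (hence `hI`) at `W = flatCfg` for the bump class with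
`C_I = 96·d·256^d`, every `M ≥ 8`, `N ≥ 1`, `d ≥ 1`.
HONEST FRAMING (page 1): lattice calculus at the TRIVIAL background; the LHCI at curved `W`, its uniqueness (F97), the Galerkin letters of the bump class, (L1)′, α₁, (L2) are
NOT here; nothing of Bałaban's asserted; (APE) NOT proved; NOT ONE-STEP, NOT NE7; spine 0∕9; finite T⁴ rung (B)+1 — NOT infinite volume, NOT mass gap, NOT `BetaPertH`,
NOT Clay.  Continuum YM on T⁴ ⇐ BetaPertH ∧ nine spine estimates (0/9 proved); BetaPertH ⇐ (D1) ∧ (D4) ∧ CAP+tail; G-an2-4 gates asym, D1 and NE2/3/4.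
-/

set_option autoImplicit false

open scoped BigOperators Matrix Matrix.Norms.L2Operator
open NormedSpace Finset

namespace Summit.QuantumFields.BalabanUV.T4Continuum.NE7CornerBumpFlatLHCI

open Literature.MathematicalPhysics.QuantumFieldTheory.Balaban1983to89
open B7Prop1Explicit B7Prop2Explicit MatrixNorms
open T4AveragingDeficitWall (IsUnitaryCfg)
open T4AveragingDeficitWallBoundary (IsPeriodicCfg periodBox mem_periodBox)
open MinimalActionWitness (flatCfg isPeriodicCfg_flatCfg)
open BlockAveragePushDirGauge (gaugeDir)
open SmoothRefineBlocks (blk res)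
open NE3CovariantCalculus (hsR hsR_add_left hsR_sum_right)
open NE3LandauOrbit (hsR_zero_right)
open NE3FlatHessianCurl (isUnitaryCfg_flatCfg)
open NE3.PairLandauB8 (covLapSite)
open NE3.LandauProjectionB8 (covLapSite_add_period sum_hsR_gaugeDir_gaugeDir_covLapSite)
open NE3.LandauCorrectionSupB8FlatH0 (covLapSite_flatCfg_eq_neg_laplacian)
open NE3.LandauCorrectionSupB8FlatUnit (sum_covLapSite_flatCfg_eq_zero)
open NE3.FlatBlockHarmonicInverse (sum_hsR_covLapSite_comm)
open PeriodicChoice (apply_wrap_eq)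
open NE7PinnedLandauLettersOfLHCI (covLapSite_add')
open NE7ProfileFieldFlat (profS_add_period profS_mem_skew profS_corner norm_profS_le covLapSite_flatCfg_profS sum_hsR_profS)

noncomputable section

variable {d : ℕ}

/-! ## §1 The one-dimensional profile `ψ(t) = ((t−2)(M−2−t))²` on `2 ≤ t ≤ M−2`, `0` elsewhere -/

/-- `ψ ≥ 0`. [folklore] -/
theorem psi_nonneg {M : ℕ} {ψ : ℤ → ℝ} (hψ : ∀ t : ℤ, ψ t = if 2 ≤ t ∧ t ≤ (M : ℤ) - 2 then (((t : ℝ) - 2) * ((M : ℝ) - 2 - t)) ^ 2 else 0)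
    (t : ℤ) : 0 ≤ ψ t := by
  rw [hψ]; split_ifs <;> positivity

/-- `ψ ≤ M⁴∕16`. [folklore] -/
theorem psi_le {M : ℕ} (hM : 2 ≤ M) {ψ : ℤ → ℝ} (hψ : ∀ t : ℤ, ψ t = if 2 ≤ t ∧ t ≤ (M : ℤ) - 2 then (((t : ℝ) - 2) * ((M : ℝ) - 2 - t)) ^ 2 else 0)
    (t : ℤ) : ψ t ≤ (M : ℝ) ^ 4 / 16 := by
  rw [hψ]
  split_ifs with h
  · obtain ⟨h1, h2⟩ := h
    have h1' : (2 : ℝ) ≤ t := by exact_mod_cast h1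
    have h2' : (t : ℝ) ≤ (M : ℝ) - 2 := by
      have : ((t : ℤ) : ℝ) ≤ (((M : ℤ) - 2 : ℤ) : ℝ) := by exact_mod_cast h2
      push_cast at this; exact this
    have hM' : (2 : ℝ) ≤ M := by exact_mod_cast hM
    have hv0 : 0 ≤ ((t : ℝ) - 2) * ((M : ℝ) - 2 - t) := mul_nonneg (by linarith) (by linarith)
    have hv1 : ((t : ℝ) - 2) * ((M : ℝ) - 2 - t) ≤ (M : ℝ) ^ 2 / 4 := by
      nlinarith [sq_nonneg ((t : ℝ) - 2 - ((M : ℝ) - 2 - t))]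
    calc (((t : ℝ) - 2) * ((M : ℝ) - 2 - t)) ^ 2 ≤ ((M : ℝ) ^ 2 / 4) ^ 2 := pow_le_pow_left₀ hv0 hv1 2
      _ = (M : ℝ) ^ 4 / 16 := by ring
  · positivity

/-- The support of `ψ` is `3 ≤ t ≤ M − 3`. [folklore] -/
theorem psi_support {M : ℕ} {ψ : ℤ → ℝ} (hψ : ∀ t : ℤ, ψ t = if 2 ≤ t ∧ t ≤ (M : ℤ) - 2 then (((t : ℝ) - 2) * ((M : ℝ) - 2 - t)) ^ 2 else 0)
    {t : ℤ} (ht : ψ t ≠ 0) : 3 ≤ t ∧ t ≤ (M : ℤ) - 3 := by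
  rw [hψ] at ht
  split_ifs at ht with h
  · obtain ⟨h1, h2⟩ := h
    have hne := pow_ne_zero_iff (n := 2) (by norm_num) |>.mp ht
    have ha : (t : ℝ) - 2 ≠ 0 := fun h0 => hne (by rw [h0, zero_mul])
    have hb : (M : ℝ) - 2 - t ≠ 0 := fun h0 => hne (by rw [h0, mul_zero])
    have ha' : t ≠ 2 := fun h0 => ha (by rw [h0]; push_cast; ring)
    have hb' : t ≠ (M : ℤ) - 2 := fun h0 => hb (by rw [h0]; push_cast; ring)
    omega
  · exact absurd rfl ht

/-- **THE SECOND DIFFERENCES OF `ψ` ARE `≤ 3M²`** (`M ≥ 8`): inside, `p(u+1) − 2p(u) + p(u−1) = 2K² + 2 − 12u(K−u)` for `p(u) = (u(K−u))²`, `K = M − 4`; at the two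
ends the only non-zero value is `(M−5)²`. [folklore] -/
theorem abs_sdiff_psi_le {M : ℕ} (hM : 8 ≤ M) {ψ : ℤ → ℝ}
    (hψ : ∀ t : ℤ, ψ t = if 2 ≤ t ∧ t ≤ (M : ℤ) - 2 then (((t : ℝ) - 2) * ((M : ℝ) - 2 - t)) ^ 2 else 0) (t : ℤ) :
    |ψ (t + 1) - 2 * ψ t + ψ (t - 1)| ≤ 3 * (M : ℝ) ^ 2 := by
  have hM' : (8 : ℝ) ≤ M := by exact_mod_cast hM
  have hMz : (8 : ℤ) ≤ (M : ℤ) := by exact_mod_cast hM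
  rcases (by omega : t ≤ 0 ∨ t = 1 ∨ t = 2 ∨ (3 ≤ t ∧ t ≤ (M : ℤ) - 3) ∨ t = (M : ℤ) - 2 ∨ t = (M : ℤ) - 1 ∨ (M : ℤ) ≤ t)
    with h | h | h | h | h | h | h
  · rw [hψ (t + 1), hψ t, hψ (t - 1), if_neg (by omega), if_neg (by omega), if_neg (by omega)]
    rw [abs_le]; constructor <;> nlinarith
  · subst h
    rw [hψ, hψ, hψ, if_pos (by omega), if_neg (by omega), if_neg (by omega)]
    push_cast
    rw [abs_le]; constructor <;> nlinarith
  · subst h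
    rw [hψ, hψ, hψ, if_pos (by omega), if_pos (by omega), if_neg (by omega)]
    push_cast
    rw [abs_le]; constructor <;> nlinarith
  · obtain ⟨h3, h4⟩ := h
    rw [hψ (t + 1), hψ t, hψ (t - 1), if_pos (by omega), if_pos (by omega), if_pos (by omega)]
    push_cast
    have h3' : (3 : ℝ) ≤ t := by exact_mod_cast h3
    have h4' : (t : ℝ) ≤ (M : ℝ) - 3 := by
      have : ((t : ℤ) : ℝ) ≤ (((M : ℤ) - 3 : ℤ) : ℝ) := by exact_mod_cast h4
      push_cast at this; exact this
    have hid : (((t : ℝ) + 1 - 2) * ((M : ℝ) - 2 - ((t : ℝ) + 1))) ^ 2 - 2 * (((t : ℝ) - 2) * ((M : ℝ) - 2 - t)) ^ 2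
        + (((t : ℝ) - 1 - 2) * ((M : ℝ) - 2 - ((t : ℝ) - 1))) ^ 2
        = 2 * ((M : ℝ) - 4) ^ 2 + 2 - 12 * (((t : ℝ) - 2) * ((M : ℝ) - 2 - t)) := by ring
    rw [hid]
    have hv0 : 0 ≤ ((t : ℝ) - 2) * ((M : ℝ) - 2 - t) := mul_nonneg (by linarith) (by linarith)
    have hv1 : 4 * (((t : ℝ) - 2) * ((M : ℝ) - 2 - t)) ≤ ((M : ℝ) - 4) ^ 2 := by
      nlinarith [sq_nonneg ((t : ℝ) - 2 - ((M : ℝ) - 2 - t))]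
    rw [abs_le]; constructor <;> nlinarith
  · subst h
    rw [hψ, hψ, hψ, if_neg (by omega), if_pos (by omega), if_pos (by omega)]
    push_cast
    rw [abs_le]; constructor <;> nlinarith
  · subst h
    rw [hψ, hψ, hψ, if_neg (by omega), if_neg (by omega), if_pos (by omega)]
    push_cast
    rw [abs_le]; constructor <;> nlinarith
  · rw [hψ (t + 1), hψ t, hψ (t - 1), if_neg (by omega), if_neg (by omega), if_neg (by omega)]
    rw [abs_le]; constructor <;> nlinarith

/-- **THE PROFILE AT THE CENTRE**: `ψ(⌊M∕2⌋) ≥ M⁴∕4096` (`M ≥ 8`). [folklore] -/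
theorem psi_mid {M : ℕ} (hM : 8 ≤ M) {ψ : ℤ → ℝ}
    (hψ : ∀ t : ℤ, ψ t = if 2 ≤ t ∧ t ≤ (M : ℤ) - 2 then (((t : ℝ) - 2) * ((M : ℝ) - 2 - t)) ^ 2 else 0) :
    (M : ℝ) ^ 4 / 4096 ≤ ψ ((M / 2 : ℕ) : ℤ) := by
  have h2 : 2 * (M / 2) ≤ M := Nat.mul_div_le M 2
  have h3 : M < 2 * (M / 2) + 2 := by omega
  rw [hψ, if_pos (by omega), Int.cast_natCast]
  have hM' : (8 : ℝ) ≤ M := by exact_mod_cast hM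
  have hm1 : 2 * ((M / 2 : ℕ) : ℝ) ≤ M := by exact_mod_cast h2
  have hm2 : (M : ℝ) ≤ 2 * ((M / 2 : ℕ) : ℝ) + 1 := by exact_mod_cast (by omega : M ≤ 2 * (M / 2) + 1)
  have ha : (M : ℝ) / 8 ≤ ((M / 2 : ℕ) : ℝ) - 2 := by linarith
  have hb : (M : ℝ) / 8 ≤ (M : ℝ) - 2 - ((M / 2 : ℕ) : ℝ) := by linarith
  have h8 : 0 ≤ (M : ℝ) / 8 := by positivity
  have hprod : (M : ℝ) / 8 * ((M : ℝ) / 8) ≤ (((M / 2 : ℕ) : ℝ) - 2) * ((M : ℝ) - 2 - ((M / 2 : ℕ) : ℝ)) :=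
    mul_le_mul ha hb h8 (h8.trans ha)
  calc (M : ℝ) ^ 4 / 4096 = ((M : ℝ) / 8 * ((M : ℝ) / 8)) ^ 2 := by ring
    _ ≤ _ := pow_le_pow_left₀ (by positivity) hprod 2

/-! ## §2 The `d`-dimensional corner bump `ρ(r) = Π_i ψ(r_i)` -/

/-- `ρ ≥ 0`. [folklore] -/
theorem rho_nonneg {M : ℕ} {ψ : ℤ → ℝ} (hψ : ∀ t : ℤ, ψ t = if 2 ≤ t ∧ t ≤ (M : ℤ) - 2 then (((t : ℝ) - 2) * ((M : ℝ) - 2 - t)) ^ 2 else 0)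
    {ρ : Site d → ℝ} (hρ : ∀ r, ρ r = ∏ i, ψ (r i)) (r : Site d) : 0 ≤ ρ r := by
  rw [hρ]; exact Finset.prod_nonneg fun i _ => psi_nonneg hψ _

/-- `ρ ≤ (M⁴∕16)^d`. [folklore] -/
theorem rho_le {M : ℕ} (hM : 2 ≤ M) {ψ : ℤ → ℝ} (hψ : ∀ t : ℤ, ψ t = if 2 ≤ t ∧ t ≤ (M : ℤ) - 2 then (((t : ℝ) - 2) * ((M : ℝ) - 2 - t)) ^ 2 else 0)
    {ρ : Site d → ℝ} (hρ : ∀ r, ρ r = ∏ i, ψ (r i)) (r : Site d) : ρ r ≤ ((M : ℝ) ^ 4 / 16) ^ d := by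
  rw [hρ]
  calc ∏ i, ψ (r i) ≤ ∏ _i : Fin d, (M : ℝ) ^ 4 / 16 := Finset.prod_le_prod (fun i _ => psi_nonneg hψ _) (fun i _ => psi_le hM hψ _)
    _ = ((M : ℝ) ^ 4 / 16) ^ d := by rw [Finset.prod_const, Finset.card_univ, Fintype.card_fin]

/-- The support of `ρ` is `[3, M−3]^d`. [folklore] -/
theorem rho_support {M : ℕ} {ψ : ℤ → ℝ} (hψ : ∀ t : ℤ, ψ t = if 2 ≤ t ∧ t ≤ (M : ℤ) - 2 then (((t : ℝ) - 2) * ((M : ℝ) - 2 - t)) ^ 2 else 0)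
    {ρ : Site d → ℝ} (hρ : ∀ r, ρ r = ∏ i, ψ (r i)) {r : Site d} (hr : ρ r ≠ 0) (i : Fin d) : 3 ≤ r i ∧ r i ≤ (M : ℤ) - 3 := by
  rw [hρ] at hr
  exact psi_support hψ (Finset.prod_ne_zero_iff.mp hr i (Finset.mem_univ i))

/-- `ρ` is boundary-free (F95's hypothesis shape). [folklore] -/
theorem rho_boundaryFree {M : ℕ} {ψ : ℤ → ℝ} (hψ : ∀ t : ℤ, ψ t = if 2 ≤ t ∧ t ≤ (M : ℤ) - 2 then (((t : ℝ) - 2) * ((M : ℝ) - 2 - t)) ^ 2 else 0)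
    {ρ : Site d → ℝ} (hρ : ∀ r, ρ r = ∏ i, ψ (r i)) (r : Site d) (hr : ρ r ≠ 0) (i : Fin d) : 1 ≤ r i ∧ r i ≤ (M : ℤ) - 2 := by
  have := rho_support hψ hρ hr i; omega

/-- **THE BUMP AT ITS CENTRE**: `ρ(⌊M∕2⌋·𝟙) ≥ (M⁴∕4096)^d > 0` (`M ≥ 8`). [folklore] -/
theorem rho_mid {M : ℕ} (hM : 8 ≤ M) {ψ : ℤ → ℝ}
    (hψ : ∀ t : ℤ, ψ t = if 2 ≤ t ∧ t ≤ (M : ℤ) - 2 then (((t : ℝ) - 2) * ((M : ℝ) - 2 - t)) ^ 2 else 0)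
    {ρ : Site d → ℝ} (hρ : ∀ r, ρ r = ∏ i, ψ (r i)) :
    ((M : ℝ) ^ 4 / 4096) ^ d ≤ ρ (fun _ => ((M / 2 : ℕ) : ℤ)) := by
  rw [hρ]
  calc ((M : ℝ) ^ 4 / 4096) ^ d = ∏ _i : Fin d, (M : ℝ) ^ 4 / 4096 := by rw [Finset.prod_const, Finset.card_univ, Fintype.card_fin]
    _ ≤ _ := Finset.prod_le_prod (fun i _ => by positivity) (fun i _ => psi_mid hM hψ)

/-- `ρ(⌊M∕2⌋·𝟙) > 0` (`M ≥ 8`). [folklore] -/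
theorem rho_mid_pos {M : ℕ} (hM : 8 ≤ M) {ψ : ℤ → ℝ}
    (hψ : ∀ t : ℤ, ψ t = if 2 ≤ t ∧ t ≤ (M : ℤ) - 2 then (((t : ℝ) - 2) * ((M : ℝ) - 2 - t)) ^ 2 else 0)
    {ρ : Site d → ℝ} (hρ : ∀ r, ρ r = ∏ i, ψ (r i)) : 0 < ρ (fun _ => ((M / 2 : ℕ) : ℤ)) := by
  have hM' : (0 : ℝ) < M := by exact_mod_cast (by omega : 0 < M)
  exact lt_of_lt_of_le (by positivity) (rho_mid hM hψ hρ)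

/-- **THE LAPLACIAN OF THE BUMP IS `≤ 3dM²(M⁴∕16)^{d−1}`**: `|Σ_ν (2ρ(r) − ρ(r−e_ν) − ρ(r+e_ν))| ≤ 3·d·M²·(M⁴∕16)^{d−1}` (`M ≥ 8`). [folklore] -/
theorem abs_lap_rho_le {M : ℕ} (hM : 8 ≤ M) {ψ : ℤ → ℝ}
    (hψ : ∀ t : ℤ, ψ t = if 2 ≤ t ∧ t ≤ (M : ℤ) - 2 then (((t : ℝ) - 2) * ((M : ℝ) - 2 - t)) ^ 2 else 0)
    {ρ : Site d → ℝ} (hρ : ∀ r, ρ r = ∏ i, ψ (r i)) (r : Site d) :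
    |∑ ν : Fin d, (2 * ρ r - ρ (r - e ν) - ρ (r + e ν))| ≤ 3 * d * (M : ℝ) ^ 2 * ((M : ℝ) ^ 4 / 16) ^ (d - 1) := by
  have hM2 : 2 ≤ M := by omega
  have hterm : ∀ ν : Fin d, |2 * ρ r - ρ (r - e ν) - ρ (r + e ν)| ≤ 3 * (M : ℝ) ^ 2 * ((M : ℝ) ^ 4 / 16) ^ (d - 1) := by
    intro ν
    have hp : ρ r = ψ (r ν) * ∏ i ∈ Finset.univ.erase ν, ψ (r i) := by
      rw [hρ, ← Finset.mul_prod_erase _ _ (Finset.mem_univ ν)]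
    have hplus : ρ (r + e ν) = ψ (r ν + 1) * ∏ i ∈ Finset.univ.erase ν, ψ (r i) := by
      rw [hρ, ← Finset.mul_prod_erase _ _ (Finset.mem_univ ν)]
      congr 1
      · simp [e_apply]
      · exact Finset.prod_congr rfl fun i hi => by simp [e_apply, Finset.ne_of_mem_erase hi]
    have hminus : ρ (r - e ν) = ψ (r ν - 1) * ∏ i ∈ Finset.univ.erase ν, ψ (r i) := by
      rw [hρ, ← Finset.mul_prod_erase _ _ (Finset.mem_univ ν)]
      congr 1
      · simp [e_apply]
      · exact Finset.prod_congr rfl fun i hi => by simp [e_apply, Finset.ne_of_mem_erase hi]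
    have hP0 : 0 ≤ ∏ i ∈ Finset.univ.erase ν, ψ (r i) := Finset.prod_nonneg fun i _ => psi_nonneg hψ _
    have hP1 : ∏ i ∈ Finset.univ.erase ν, ψ (r i) ≤ ((M : ℝ) ^ 4 / 16) ^ (d - 1) := by
      calc ∏ i ∈ Finset.univ.erase ν, ψ (r i) ≤ ∏ _i ∈ Finset.univ.erase ν, (M : ℝ) ^ 4 / 16 :=
            Finset.prod_le_prod (fun i _ => psi_nonneg hψ _) (fun i _ => psi_le hM2 hψ _)
        _ = ((M : ℝ) ^ 4 / 16) ^ (d - 1) := by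
            rw [Finset.prod_const, Finset.card_erase_of_mem (Finset.mem_univ ν), Finset.card_univ, Fintype.card_fin]
    rw [hp, hplus, hminus]
    have hfac : 2 * (ψ (r ν) * ∏ i ∈ Finset.univ.erase ν, ψ (r i)) - ψ (r ν - 1) * ∏ i ∈ Finset.univ.erase ν, ψ (r i)
        - ψ (r ν + 1) * ∏ i ∈ Finset.univ.erase ν, ψ (r i)
        = -(ψ (r ν + 1) - 2 * ψ (r ν) + ψ (r ν - 1)) * ∏ i ∈ Finset.univ.erase ν, ψ (r i) := by ring
    rw [hfac, abs_mul, abs_neg, abs_of_nonneg hP0]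
    exact mul_le_mul (abs_sdiff_psi_le hM hψ _) hP1 hP0 (by positivity)
  calc |∑ ν : Fin d, (2 * ρ r - ρ (r - e ν) - ρ (r + e ν))| ≤ ∑ ν : Fin d, |2 * ρ r - ρ (r - e ν) - ρ (r + e ν)| := Finset.abs_sum_le_sum_abs _ _
    _ ≤ ∑ _ν : Fin d, 3 * (M : ℝ) ^ 2 * ((M : ℝ) ^ 4 / 16) ^ (d - 1) := Finset.sum_le_sum fun ν _ => hterm ν
    _ = 3 * d * (M : ℝ) ^ 2 * ((M : ℝ) ^ 4 / 16) ^ (d - 1) := by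
        rw [Finset.sum_const, Finset.card_univ, Fintype.card_fin, nsmul_eq_mul]; ring

/-! ## §3 The flat LHCI of the bump class, explicit -/

variable {n : Type*} [Fintype n] [DecidableEq n]

omit [Fintype n] [DecidableEq n] in
/-- An `N`-periodic corner datum is constant on the corner class of `0`: `a(N•w) = a(0)`. [folklore] -/
theorem corner_datum_class_zero {N : ℕ} {a : Site d → Matrix n n ℂ} (haP : ∀ (w : Site d) (i : Fin d), a (w + (N : ℤ) • e i) = a w)
    (w : Site d) : a ((N : ℤ) • w) = a 0 := by
  have h1 := apply_wrap_eq haP ((N : ℤ) • w)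
  have h2 := apply_wrap_eq haP 0
  have e1 : (fun κ => ((N : ℤ) • w) κ % (N : ℤ)) = fun κ => (0 : Site d) κ % (N : ℤ) := by
    funext κ; simp [Int.mul_emod_right]
  rw [← h1, e1, h2]

/-- The flat covariant Laplacian kills constants. [folklore] -/
theorem covLapSite_flatCfg_const (K : Matrix n n ℂ) (y : Site d) : covLapSite (flatCfg (d := d) (n := n)) (fun _ => K) y = 0 := by
  rw [covLapSite_flatCfg_eq_neg_laplacian]; simp

/-- **THE LANDAU-HARMONIC CORNER INTERPOLATION OF THE BUMP CLASS AT THE FLAT BACKGROUND, EXPLICIT** — F90's letter `hIR` (and `hI`) at `W = flatCfg`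
for ANY test class `T` whose members are `hsR`-orthogonal to `Δ_1²(Φ_ρ C)` for every skew `N`-periodic coarse datum `C` vanishing on the corner class of `0`
(clause (i) of the bump class): every skew `N`-periodic corner datum `a` has the interpolant `η = a(0) + Φ_ρ((ρ s)⁻¹(a − a(0)))`, skew, `(N·M)`-periodic,
`η(M•w) = a(w)`, `gaugeDir_1 η` Landau against `T`, and `‖Δ_1η‖ ≤ (96·d·256^d∕M²)·‖a‖_∞` (`M ≥ 8`, `N ≥ 1`, `d ≥ 1`). [folklore] -/
theorem exists_lhci_flatCfg_bump (hd : 1 ≤ d) {M N : ℕ} (hM : 8 ≤ M) (hN : 1 ≤ N) {ψ : ℤ → ℝ}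
    (hψ : ∀ t : ℤ, ψ t = if 2 ≤ t ∧ t ≤ (M : ℤ) - 2 then (((t : ℝ) - 2) * ((M : ℝ) - 2 - t)) ^ 2 else 0)
    {ρ : Site d → ℝ} (hρ : ∀ r, ρ r = ∏ i, ψ (r i)) {s : Site d} (hs : s = fun _ => ((M / 2 : ℕ) : ℤ))
    (T : (Site d → Matrix n n ℂ) → Prop)
    (hT : ∀ nu : Site d → Matrix n n ℂ, T nu → ∀ C : Site d → Matrix n n ℂ, (∀ w, C w ∈ skewAdjoint (Matrix n n ℂ)) →
      (∀ (w : Site d) (i : Fin d), C (w + (N : ℤ) • e i) = C w) → (∀ w : Site d, C ((N : ℤ) • w) = 0) →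
      ∑ y ∈ periodBox (d := d) (N * M), hsR ((fun x => ρ (res M (x + s)) • C (blk M (x + s))) y)
        (covLapSite (flatCfg (d := d) (n := n)) (covLapSite (flatCfg (d := d) (n := n)) nu) y) = 0) :
    ∀ a : Site d → Matrix n n ℂ, (∀ w, a w ∈ skewAdjoint (Matrix n n ℂ)) → (∀ (w : Site d) (i : Fin d), a (w + (N : ℤ) • e i) = a w) →
      ∃ eta : Site d → Matrix n n ℂ,
        (∀ y, eta y ∈ skewAdjoint (Matrix n n ℂ)) ∧ (∀ (y : Site d) (i : Fin d), eta (y + ((N * M : ℕ) : ℤ) • e i) = eta y) ∧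
        (∀ w : Site d, eta (((M : ℕ) : ℤ) • w) = a w) ∧
        (∀ nu : Site d → Matrix n n ℂ, (∀ y, nu y ∈ skewAdjoint (Matrix n n ℂ)) →
            (∀ (y : Site d) (i : Fin d), nu (y + ((N * M : ℕ) : ℤ) • e i) = nu y) → T nu →
          ∑ y ∈ periodBox (d := d) (N * M), ∑ κ : Fin d,
            hsR (gaugeDir (flatCfg (d := d) (n := n)) eta y κ) (gaugeDir (flatCfg (d := d) (n := n)) (covLapSite (flatCfg (d := d) (n := n)) nu) y κ) = 0) ∧
        ∀ A : ℝ, (∀ w, ‖a w‖ ≤ A) → ∀ y, ‖covLapSite (flatCfg (d := d) (n := n)) eta y‖ ≤ (96 * d * (256 : ℝ) ^ d) / (M : ℝ) ^ 2 * A := by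
  intro a has haP
  have hM1 : 1 ≤ M := by omega
  have hP : 1 ≤ N * M := Nat.mul_pos (by omega) (by omega)
  have hM0 : (0 : ℝ) < M := by exact_mod_cast (by omega : 0 < M)
  have hWu : IsUnitaryCfg (flatCfg (d := d) (n := n)) := isUnitaryCfg_flatCfg
  have hWP : IsPeriodicCfg (flatCfg (d := d) (n := n)) ((N * M : ℕ) : ℤ) := isPeriodicCfg_flatCfg _
  have hρs : 0 < ρ s := by rw [hs]; exact rho_mid_pos hM hψ hρ
  have hs0 : ∀ i, 0 ≤ s i := fun i => by simp only [hs]; positivity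
  have hs1 : ∀ i, s i < M := fun i => by
    simp only [hs]; exact_mod_cast (Nat.div_lt_self (by omega) (by norm_num) : M / 2 < M)
  -- the coarse datum of the interpolant: vanishes on the corner class of `0`
  set C₁ : Site d → Matrix n n ℂ := fun w => (ρ s)⁻¹ • (a w - a 0) with hC₁
  have hC₁s : ∀ w, C₁ w ∈ skewAdjoint (Matrix n n ℂ) := fun w => skewAdjoint.smul_mem _ ((skewAdjoint _).sub_mem (has _) (has _))
  have hC₁P : ∀ (w : Site d) (i : Fin d), C₁ (w + (N : ℤ) • e i) = C₁ w := fun w i => by simp only [hC₁, haP]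
  have hC₁0 : ∀ w : Site d, C₁ ((N : ℤ) • w) = 0 := fun w => by simp only [hC₁, corner_datum_class_zero haP, sub_self, smul_zero]
  -- the interpolant
  set Φ : Site d → Matrix n n ℂ := fun x => ρ (res M (x + s)) • C₁ (blk M (x + s)) with hΦ
  have hΦP : ∀ (y : Site d) (i : Fin d), Φ (y + ((N * M : ℕ) : ℤ) • e i) = Φ y := fun y i => profS_add_period hM1 s ρ hC₁P y i
  refine ⟨fun y => a 0 + Φ y, fun y => (skewAdjoint _).add_mem (has _) (profS_mem_skew M s ρ hC₁s y), fun y i => by simp only [hΦP], fun w => ?_,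
    fun nu hnus hnuP hnuT => ?_, fun A hA y => ?_⟩
  · -- corner values
    show a 0 + Φ ((M : ℤ) • w) = a w
    have h := profS_corner hM1 hs0 hs1 ρ C₁ w
    simp only at h
    rw [hΦ]; simp only
    rw [h, hC₁]; simp only
    rw [smul_smul, mul_inv_cancel₀ hρs.ne', one_smul, add_sub_cancel]
  · -- Landau against `T`: `Σ hsR (D η)(D Δν) = Σ hsR (Δη)(Δν) = Σ hsR η (Δ²ν) = hsR (a 0) (Σ Δ²ν) + [clause (i)] = 0`
    have hetaP : ∀ (y : Site d) (i : Fin d), (fun y => a 0 + Φ y) (y + ((N * M : ℕ) : ℤ) • e i) = (fun y => a 0 + Φ y) y := fun y i => by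
      simp only [hΦP]
    have hΔnuP := covLapSite_add_period hWP hnuP
    rw [sum_hsR_gaugeDir_gaugeDir_covLapSite hP hWu hWP hetaP hnuP, sum_hsR_covLapSite_comm hP hetaP hΔnuP]
    simp only [hsR_add_left, Finset.sum_add_distrib]
    rw [← hsR_sum_right, sum_covLapSite_flatCfg_eq_zero hP hΔnuP, hsR_zero_right, zero_add]
    exact hT nu hnuT C₁ hC₁s hC₁P hC₁0
  · -- the Laplacian bound
    have hA0 : 0 ≤ A := (norm_nonneg _).trans (hA 0)
    have hsplit : covLapSite (flatCfg (d := d) (n := n)) (fun y => a 0 + Φ y) y = covLapSite (flatCfg (d := d) (n := n)) Φ y := by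
      rw [covLapSite_add' (flatCfg (d := d) (n := n)) (fun _ => a 0) Φ y, covLapSite_flatCfg_const, zero_add]
    rw [hsplit, hΦ, covLapSite_flatCfg_profS hM1 s (rho_boundaryFree hψ hρ) C₁ y]
    have hCA : ∀ w, ‖C₁ w‖ ≤ (ρ s)⁻¹ * (2 * A) := fun w => by
      rw [hC₁]; simp only
      rw [norm_smul, Real.norm_eq_abs, abs_of_pos (inv_pos.mpr hρs)]
      refine mul_le_mul_of_nonneg_left ?_ (inv_pos.mpr hρs).le
      calc ‖a w - a 0‖ ≤ ‖a w‖ + ‖a 0‖ := norm_sub_le _ _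
        _ ≤ 2 * A := by linarith [hA w, hA 0]
    have hG : ∀ r : Site d, |∑ ν : Fin d, (2 * ρ r - ρ (r - e ν) - ρ (r + e ν))| ≤ 3 * d * (M : ℝ) ^ 2 * ((M : ℝ) ^ 4 / 16) ^ (d - 1) :=
      fun r => abs_lap_rho_le hM hψ hρ r
    refine (norm_profS_le M s hG hCA y).trans ?_
    -- `(ρ s)⁻¹ ≤ (4096∕M⁴)^d` and the arithmetic `3dM²(M⁴∕16)^{d−1}·(4096∕M⁴)^d·2 = 96·d·256^d∕M²`
    have hinv : (ρ s)⁻¹ ≤ ((4096 : ℝ) / (M : ℝ) ^ 4) ^ d := by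
      have h1 : ((M : ℝ) ^ 4 / 4096) ^ d ≤ ρ s := by rw [hs]; exact rho_mid hM hψ hρ
      have h2 : 0 < ((M : ℝ) ^ 4 / 4096) ^ d := by positivity
      calc (ρ s)⁻¹ ≤ (((M : ℝ) ^ 4 / 4096) ^ d)⁻¹ := by
            rw [inv_le_inv₀ hρs h2]; exact h1
        _ = ((4096 : ℝ) / (M : ℝ) ^ 4) ^ d := by rw [← inv_pow, inv_div]
    obtain ⟨k, rfl⟩ : ∃ k, d = k + 1 := ⟨d - 1, by omega⟩
    have hGnn : 0 ≤ 3 * ((k + 1 : ℕ) : ℝ) * (M : ℝ) ^ 2 * ((M : ℝ) ^ 4 / 16) ^ (k + 1 - 1) := by positivity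
    calc 3 * ((k + 1 : ℕ) : ℝ) * (M : ℝ) ^ 2 * ((M : ℝ) ^ 4 / 16) ^ (k + 1 - 1) * ((ρ s)⁻¹ * (2 * A))
        ≤ 3 * ((k + 1 : ℕ) : ℝ) * (M : ℝ) ^ 2 * ((M : ℝ) ^ 4 / 16) ^ (k + 1 - 1) * (((4096 : ℝ) / (M : ℝ) ^ 4) ^ (k + 1) * (2 * A)) :=
          mul_le_mul_of_nonneg_left (mul_le_mul_of_nonneg_right hinv (by positivity)) hGnn
      _ = (96 * ((k + 1 : ℕ) : ℝ) * (256 : ℝ) ^ (k + 1)) / (M : ℝ) ^ 2 * A := by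
          have hM4 : (M : ℝ) ^ 4 ≠ 0 := by positivity
          have h4096 : (4096 : ℝ) ^ k = 16 ^ k * 256 ^ k := by rw [← mul_pow]; norm_num
          simp only [Nat.add_sub_cancel, pow_succ, div_pow]
          field_simp
          rw [h4096]
          ring

end

end Summit.QuantumFields.BalabanUV.T4Continuum.NE7CornerBumpFlatLHCI
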